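import Literature.NumberTheory.Transcendental.NesterenkoUResultantSpecialize
import Literature.NumberTheory.Transcendental.NesterenkoEliminationProp411Cycle
import Literature.NumberTheory.Transcendental.NesterenkoEliminationProp44Holds
import Literature.NumberTheory.Transcendental.NesterenkoChowFormDistinct
import Mathlib.Algebra.Algebra.Hom.Rat
import Mathlib.Algebra.MvPolynomial.NoZeroDivisors
import HarnessLib

/-!
# The `u`-resultant of the Chow form of a prime with a form, IV: it is the associated form of the intersection cycle (towards LNM 1752 Ch. 3 Prop. 4.11, route B)

`Literature/NumberTheory/Transcendental/NesterenkoUResultantChow.lean`. Let `𝔭 ⊂ ℚ[x₀, …, x_m]`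
be a homogeneous prime of rank `s + 1` (`2 ≤ s + 1 ≤ m`), `Q ∉ 𝔭` a form of degree `d ≥ 1` with
integer model `Q₀` (`Q = q · Q₀`), `𝓠` the set of minimal primes `𝔮` of `(𝔭, Q)` (homogeneous
primes of rank `s`, `NesterenkoEliminationProp411Cut.lean`), `F_𝔮 = chowForm 𝔮 s` their associated
forms, and `G = uResultant 𝔭 s d Q₀ ∈ ℚ[u₁, …, u_s]` the `u`-resultant
(`NesterenkoUResultantIntegral.lean`). Using the two specialisations of
`NesterenkoUResultantSpecialize.lean` we prove (this is [Nes77]/[Nes10]'s "Lemma 6": the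
resultant is a Chow form whose irreducible factors are the Chow forms of the minimal primes of
`(𝔭, Q)`):

* `chowForm_dvd_uResultant` — **`F_𝔮 ∣ G`** for every `𝔮 ∈ 𝓠`: at the generic point of
  `F_𝔮 = 0` the specialised hyperplanes pass through a point `β` of `V(𝔮) ⊆ V(𝔭) ∩ V(Q)` (zeros
  theorem), so `F(φ(u); v) = ĉ ∏ (β̂⁽ⁱ⁾ · v)` vanishes for all `v ⊥ β`, whence some `β̂⁽ⁱ⁾ ∥ β`,
  `Q₀(β̂⁽ⁱ⁾) = 0` and `φ(G) = 0`, i.e. `F_𝔮 ∣ G`;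
* `exists_associated_chowForm_of_prime_dvd` — **every prime factor `H` of `G` is associated to
  some `F_𝔮`**: at the generic point of `H = 0`, `φ(G) = ĉ^d ∏ Q₀(β̂⁽ⁱ⁾) = 0`; `ĉ = 0` would make
  `H` divide all coefficients of the irreducible `F`, impossible; so some `β̂⁽ⁱ⁾` is a zero of
  `(𝔭, Q)`, hence of a minimal prime `𝔮`, on the hyperplanes `φ(u)`, so `φ(F_𝔮) = 0`, `H ∣ F_𝔮`;
* `uResultant_ne_zero`; `exists_uResultant_eq_C_mul_prod_pow` — **`G = c ∏_{𝔮 ∈ 𝓠} F_𝔮^{e_𝔮}`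
  with `c ≠ 0`, all `e_𝔮 ≥ 1`** (unique factorisation);
* `exists_cycle_ideal_uResultant` — hence (Prop. 4.4, `exists_cycle_ideal`) a homogeneous ideal
  `J`, unmixed of rank `s`, with `V(J) = V((𝔭, Q))` and associated form `chowForm J s = c' · G`,
  `c' ≠ 0`: the `J` of Proposition 4.11, whose invariants are those of `G`.

No definitions, no named facts.

## References

* [NesterenkoPhilippon2001] Yu. V. Nesterenko, P. Philippon (eds.), *Introduction to Algebraic
  Independence Theory*, LNM 1752, Springer 2001, Ch. 3 §4, Prop. 4.4 (p. 38), Prop. 4.11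
  (pp. 40–41; PDF pp. 52–53).
* [Nes10] Yu. V. Nesterenko, Proc. Steklov Inst. Math. 218 (1997) 294–331, Prop. 1.4.
* [Nesterenko1977] Yu. V. Nesterenko, Izv. Akad. Nauk SSSR Ser. Mat. 41 (1977), §2 (Lemma 6:
  the resultant of a Chow form and a form).
-/

noncomputable section

open MvPolynomial
open Literature.NumberTheory.Transcendental.PhilipponMain

attribute [local instance] MvPolynomial.gradedAlgebra

namespace Literature.NumberTheory.Transcendental

namespace Nesterenko

variable {m : ℕ}

/-! ### Generalities -/

/-- A ring homomorphism out of `ℚ[U]` into a `ℚ`-algebra is evaluation at the images of the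
variables. [folklore] -/
theorem ringHom_eq_aeval {σ L : Type*} [CommRing L] [Algebra ℚ L] (φ : MvPolynomial σ ℚ →+* L)
    (H : MvPolynomial σ ℚ) : φ H = aeval (fun w => φ (X w)) H := by
  have key : φ = ((aeval (R := ℚ) fun w => φ (X w) : MvPolynomial σ ℚ →ₐ[ℚ] L) :
      MvPolynomial σ ℚ →+* L) := by
    refine ringHom_ext (fun q => ?_) (fun w => ?_)
    · change φ (C q) = aeval _ (C q)
      rw [aeval_C, ← RingHom.comp_apply φ C q, RingHom.ext_rat (φ.comp C) (algebraMap ℚ L)]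
    · change φ (X w) = aeval _ (X w)
      rw [aeval_X]
  exact RingHom.congr_fun key H

/-- `Q(λ β) = λ^d Q(β)` for a form of degree `d` over `R`, in any commutative `R`-algebra
(whatever the algebra structure). [folklore] -/
theorem aeval_smul_of_isHomogeneous' {R S : Type*} [CommSemiring R] [CommRing S] [Algebra R S]
    {Q : MvPolynomial (Fin (m + 1)) R} {d : ℕ} (hQ : Q.IsHomogeneous d) (c : S)
    (β : Fin (m + 1) → S) : aeval (c • β) Q = c ^ d * aeval β Q := by
  classical
  rw [aeval_def, aeval_def, eval₂_eq', eval₂_eq', Finset.mul_sum]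
  refine Finset.sum_congr rfl fun e he => ?_
  have hsd : ∑ i, e i = d := by
    have h := hQ (mem_support_iff.1 he)
    rw [Finsupp.weight_apply, Finsupp.sum_fintype _ _ (fun i => by simp)] at h
    simpa using h
  simp only [Pi.smul_apply, smul_eq_mul, mul_pow, Finset.prod_mul_distrib,
    Finset.prod_pow_eq_pow_sum, hsd]
  ring

/-- An integer model of a rational form: `Q = q · Q₀`, `q ≠ 0`, `Q₀ ∈ ℤ[x̲]` a form of the same
degree. [folklore] -/
theorem exists_int_model {Q : Rx m} {d : ℕ} (hQ : Q.IsHomogeneous d) (hQ0 : Q ≠ 0) :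
    ∃ (q : ℚ) (Q₀ : MvPolynomial (Fin (m + 1)) ℤ), q ≠ 0 ∧
      Q = C q * MvPolynomial.map (Int.castRingHom ℚ) Q₀ ∧ Q₀.IsHomogeneous d := by
  obtain ⟨c, hc, Z, hQZ, hsupp, -⟩ := exists_eq_C_mul_map_primitive Q hQ0
  refine ⟨c, Z, hc, hQZ, fun e he => hQ ?_⟩
  have : e ∈ Q.support := hsupp ▸ mem_support_iff.mpr he
  exact mem_support_iff.mp this

/-- `Q₀(β) = 0` from `Q(β) = 0` (`Q = q Q₀`, `q ≠ 0`) in a `ℚ`-algebra without `ℚ`-torsion.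
[folklore] -/
theorem aeval_int_model_eq_zero {L : Type*} [Field L] [Algebra ℚ L] {Q : Rx m} {q : ℚ}
    {Q₀ : MvPolynomial (Fin (m + 1)) ℤ} (hq : q ≠ 0)
    (hQQ₀ : Q = C q * MvPolynomial.map (Int.castRingHom ℚ) Q₀) {β : Fin (m + 1) → L}
    (h : aeval β Q = 0) : aeval β Q₀ = 0 := by
  rw [hQQ₀, map_mul, ← algebraMap_int_eq, aeval_map_algebraMap, aeval_C, mul_eq_zero] at h
  exact h.resolve_left (by rw [map_eq_zero]; exact hq)

/-- `Q(β) = 0` from `Q₀(β) = 0`. [folklore] -/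
theorem aeval_eq_zero_of_int_model {L : Type*} [CommRing L] [Algebra ℚ L] {Q : Rx m} {q : ℚ}
    {Q₀ : MvPolynomial (Fin (m + 1)) ℤ}
    (hQQ₀ : Q = C q * MvPolynomial.map (Int.castRingHom ℚ) Q₀) {β : Fin (m + 1) → L}
    (h : aeval β Q₀ = 0) : aeval β Q = 0 := by
  rw [hQQ₀, map_mul, ← algebraMap_int_eq, aeval_map_algebraMap, h, mul_zero]

/-- A prime Chow form has positive degree: `deg 𝔭 ≥ 1`. [cite: NesterenkoPhilippon2001, Ch. 3
Def. 4.5 (p. 38)] -/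
theorem one_le_ideg_of_prime_chowForm {r : ℕ} (hr : 0 < r) {J : Ideal (Rx m)}
    (hpr : Prime (chowForm J r)) : 1 ≤ ideg J r := by
  classical
  set G := chowForm J r with hGdef
  have hG0 : G ≠ 0 := hpr.ne_zero
  obtain ⟨e, he, hene⟩ : ∃ e ∈ G.support, e ≠ 0 := by
    by_contra h
    push Not at h
    have hGC : G = C (G.coeff 0) := by
      ext e
      by_cases he0 : e = 0
      · subst he0; simp
      · rw [coeff_C, if_neg (Ne.symm he0)]
        by_contra hc
        exact he0 (h e (mem_support_iff.mpr hc))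
    have hc0 : G.coeff 0 ≠ 0 := fun hc => hG0 (by rw [hGC, hc, C_0])
    exact hpr.not_unit (by rw [hGC]; exact (IsUnit.mk0 _ hc0).map C)
  obtain ⟨⟨i, j⟩, hij⟩ : ∃ ij, e ij ≠ 0 := by
    by_contra h
    push Not at h
    exact hene (Finsupp.ext h)
  have h1 : 1 ≤ bdeg i e :=
    (Nat.one_le_iff_ne_zero.mpr hij).trans (Finset.single_le_sum
      (f := fun j' : Fin (m + 1) => e (i, j')) (fun _ _ => Nat.zero_le _) (Finset.mem_univ j))
  rw [← bdeg_eq_ideg_of_mem_support_chowForm J hr he i]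
  exact h1

/-! ### The setting of Proposition 4.11 -/

section Setting

variable {s : ℕ} {𝔭 : Ideal (Rx m)} {Q : Rx m} {d : ℕ} {q : ℚ} {Q₀ : MvPolynomial (Fin (m + 1)) ℤ}

/-- Facts about a minimal prime `𝔮` of `(𝔭, Q)` in the form used here: `𝔮` is a homogeneous
prime of rank `s`, its Chow form `F_𝔮 = chowForm 𝔮 s` is a prime element generating `𝔮̄(s)`,
`𝔭 ≤ 𝔮 ∋ Q`. [cite: NesterenkoPhilippon2001, Ch. 3 Prop. 4.11 (pp. 40–41)] -/
theorem minimalPrime_facts (hs : 1 ≤ s) (h𝔭 : 𝔭.IsPrime)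
    (hhom : 𝔭.IsHomogeneous (homogeneousSubmodule (Fin (m + 1)) ℚ))
    (hunm : IsUnmixedOfRank 𝔭 (s + 1)) (hQ : Q.IsHomogeneous d) (hQ𝔭 : Q ∉ 𝔭)
    {𝔮 : Ideal (Rx m)} (h𝔮 : 𝔮 ∈ (𝔭 ⊔ Ideal.span {Q}).minimalPrimes) :
    𝔮.IsPrime ∧ 𝔮.IsHomogeneous (homogeneousSubmodule (Fin (m + 1)) ℚ) ∧
      ringKrullDim (Rx m ⧸ 𝔮) = (s : ℕ) ∧ Prime (chowForm 𝔮 s) ∧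
      Ideal.span {chowForm 𝔮 s} = elimIdeal 𝔮 s ∧ 𝔭 ≤ 𝔮 ∧ Q ∈ 𝔮 := by
  obtain ⟨h𝔮p, h𝔮hom, h𝔮dim, -, hlt, hQ𝔮⟩ :=
    minimalPrimes_cut_facts (r := s + 1) (by omega) h𝔭 hhom hunm hQ hQ𝔭 h𝔮
  rw [Nat.add_sub_cancel] at h𝔮dim
  haveI := h𝔮p
  exact ⟨h𝔮p, h𝔮hom, h𝔮dim, prime_chowForm 𝔮 h𝔮hom hs h𝔮dim,
    (span_chowForm_eq_elimIdeal 𝔮 h𝔮hom hs h𝔮dim).1, hlt.le, hQ𝔮⟩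

/-- `F ∈ 𝔭̄(s+1)`. [folklore] -/
theorem chowForm_mem_elimIdeal (h𝔭 : 𝔭.IsPrime)
    (hhom : 𝔭.IsHomogeneous (homogeneousSubmodule (Fin (m + 1)) ℚ))
    (hdim : ringKrullDim (Rx m ⧸ 𝔭) = (s + 1 : ℕ)) :
    chowForm 𝔭 (s + 1) ∈ elimIdeal 𝔭 (s + 1) := by
  haveI := h𝔭
  rw [← (span_chowForm_eq_elimIdeal 𝔭 hhom (Nat.succ_pos s) hdim).1]
  exact Ideal.mem_span_singleton_self _

/-- **`F(φ(u); v) = 0` whenever the hyperplane `v` passes through a zero `β` of `𝔭` lying on the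
specialised hyperplanes `φ(u₁), …, φ(u_s)`** (the easy direction of the zeros theorem, read
through `splitLast`). [cite: NesterenkoPhilippon2001, Ch. 3 Def. 4.3 (p. 38)] -/
theorem eval_map_splitLast_chowForm_eq_zero {L : Type*} [Field L] [Algebra ℚ L] (h𝔭 : 𝔭.IsPrime)
    (hhom : 𝔭.IsHomogeneous (homogeneousSubmodule (Fin (m + 1)) ℚ))
    (hdim : ringKrullDim (Rx m ⧸ 𝔭) = (s + 1 : ℕ)) (φ : RU s m →+* L)
    {β : Fin (m + 1) → L} (hβ0 : β ≠ 0) (hβ𝔭 : ∀ P ∈ 𝔭, aeval β P = 0)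
    (hβL : ∀ i : Fin s, ∑ j, φ (X (i, j)) * β j = 0) {v : Fin (m + 1) → L}
    (hv : ∑ j, β j * v j = 0) :
    eval v (MvPolynomial.map φ (splitLast s m (chowForm 𝔭 (s + 1)))) = 0 := by
  have e := eval_map_splitLast φ.toRatAlgHom v (chowForm 𝔭 (s + 1))
  rw [RingHom.toRatAlgHom_toRingHom] at e
  rw [e]
  refine aeval_eq_zero_of_mem_elimIdeal_of_zero (chowForm_mem_elimIdeal h𝔭 hhom hdim) hβ0 hβ𝔭
    fun i => ?_
  induction i using Fin.lastCases with
  | last =>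
    simp only [lastCombine_last]
    rw [← hv]
    exact Finset.sum_congr rfl fun j _ => mul_comm _ _
  | cast i =>
    simp only [lastCombine_castSucc, RingHom.toRatAlgHom_apply]
    exact hβL i

/-- If a non-zero product of linear forms `ĉ ∏ (b⁽ⁱ⁾ · v)` over an algebraically closed field
vanishes on the hyperplane `β · v = 0`, then some `b⁽ⁱ⁾` is proportional to `β`. [folklore] -/
theorem exists_eq_smul_of_forall_eval_eq_zero {L : Type*} [Field L] [IsAlgClosed L] {cz : L}
    (hcz : cz ≠ 0) {D : ℕ} {bz : Fin D → Fin (m + 1) → L} (hbz : ∀ i, bz i ≠ 0)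
    {β : Fin (m + 1) → L} (hβ0 : β ≠ 0)
    (h : ∀ v : Fin (m + 1) → L, ∑ j, β j * v j = 0 →
      eval v (C cz * ∏ i, (∑ j, C (bz i j) * X j)) = 0) :
    ∃ i, ∃ a : L, bz i = a • β := by
  have hdvd : ((∑ j, C (β j) * X j) : MvPolynomial (Fin (m + 1)) L) ∣
      ∏ i, (∑ j, C (bz i j) * X j) := by
    refine linK_dvd_of_forall_eval hβ0 fun v hv => ?_
    have h1 := h v hv
    rw [map_mul, eval_C, mul_eq_zero] at h1
    exact h1.resolve_left hcz
  obtain ⟨i, -, hi⟩ := ((prime_linK hβ0).dvd_finsetProd_iff _).mp hdvd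
  exact ⟨i, eq_smul_of_linK_dvd_linK hβ0 (hbz i) hi⟩

/-! ### `F_𝔮 ∣ G` for every minimal prime `𝔮` of `(𝔭, Q)` -/

/-- **Every minimal prime of the cut divides the `u`-resultant**: `F_𝔮 ∣ G`.
[cite: NesterenkoPhilippon2001, Ch. 3 Prop. 4.11 (pp. 40–41)] -/
theorem chowForm_dvd_uResultant (hs : 1 ≤ s) (h𝔭 : 𝔭.IsPrime)
    (hhom : 𝔭.IsHomogeneous (homogeneousSubmodule (Fin (m + 1)) ℚ))
    (hunm : IsUnmixedOfRank 𝔭 (s + 1)) (hQ : Q.IsHomogeneous d) (hd : 1 ≤ d) (hQ𝔭 : Q ∉ 𝔭)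
    (hq : q ≠ 0) (hQQ₀ : Q = C q * MvPolynomial.map (Int.castRingHom ℚ) Q₀)
    (hQ₀ : Q₀.IsHomogeneous d) {𝔮 : Ideal (Rx m)} (h𝔮 : 𝔮 ∈ (𝔭 ⊔ Ideal.span {Q}).minimalPrimes) :
    chowForm 𝔮 s ∣ uResultant 𝔭 s d Q₀ := by
  have hdim : ringKrullDim (Rx m ⧸ 𝔭) = (s + 1 : ℕ) :=
    ringKrullDim_quotient_eq_of_isUnmixedOfRank h𝔭 hunm
  obtain ⟨h𝔮p, h𝔮hom, h𝔮dim, hP, hspan, hle, hQ𝔮⟩ := minimalPrime_facts hs h𝔭 hhom hunm hQ hQ𝔭 h𝔮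
  -- specialise at the generic point of `F_𝔮 = 0`
  haveI : CharZero (primeSpecField hP) := charZero_primeSpecField hP
  set φ := primeSpecMap hP with hφ
  obtain ⟨cz, bz, hbz0, -, -, hF, hG⟩ := exists_split_primeSpec h𝔭 hhom hdim hQ₀ hP
  rw [← primeSpecMap_eq_zero_iff hP, hG]
  by_cases hcz : cz = 0
  · rw [hcz, zero_pow (by omega), zero_mul]
  -- a point `β` of `V(𝔮)` on the hyperplanes `φ(u)`
  have hF𝔮 : aeval (fun w => φ (X w)) (chowForm 𝔮 s) = 0 := by
    rw [← ringHom_eq_aeval φ, primeSpecMap_self]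
  have hpr : (elimIdeal 𝔮 s).IsPrincipal := ⟨⟨chowForm 𝔮 s, hspan.symm⟩⟩
  obtain ⟨β, hβ0, hβ𝔮, hβL⟩ := (aeval_chowForm_eq_zero_iff_of_isAlgClosed h𝔮hom hpr _).mp hF𝔮
  have hβ𝔭 : ∀ P ∈ 𝔭, aeval β P = 0 := fun P hP' => hβ𝔮 P (hle hP')
  have hβQ₀ : aeval β Q₀ = 0 := aeval_int_model_eq_zero hq hQQ₀ (hβ𝔮 Q hQ𝔮)
  -- `F(φ(u); v) = 0` for `v ⊥ β`, so some `bz i ∥ β`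
  obtain ⟨i, a, ha⟩ := exists_eq_smul_of_forall_eval_eq_zero hcz hbz0 hβ0 fun v hv => by
    rw [← hF]
    exact eval_map_splitLast_chowForm_eq_zero h𝔭 hhom hdim φ hβ0 hβ𝔭 hβL hv
  have hi : aeval (bz i) Q₀ = 0 := by
    rw [ha, aeval_smul_of_isHomogeneous' hQ₀, hβQ₀, mul_zero]
  rw [Finset.prod_eq_zero (Finset.mem_univ i) hi, mul_zero]

/-! ### The prime factors of `G` are the `F_𝔮` -/

/-- Scaling the last group of variables multiplies the Chow form of `𝔭` by `t^{deg 𝔭}`.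
[cite: NesterenkoPhilippon2001, Ch. 3, remark after Prop. 4.4 (p. 38)] -/
theorem scaleU_last_chowForm (s : ℕ) (𝔭 : Ideal (Rx m)) (t : ℚ) :
    scaleU (s + 1) m (Fin.last s) t (chowForm 𝔭 (s + 1)) =
      C (t ^ ideg 𝔭 (s + 1)) * chowForm 𝔭 (s + 1) := by
  classical
  ext e
  rw [coeff_scaleU, coeff_C_mul]
  by_cases he : e ∈ (chowForm 𝔭 (s + 1)).support
  · rw [bdeg_eq_ideg_of_mem_support_chowForm 𝔭 (Nat.succ_pos s) he]
  · rw [notMem_support_iff.mp he, mul_zero, mul_zero]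

/-- An element of `ℚ[u₁, …, u_{s+1}]` coming from `ℚ[u₁, …, u_s]` is fixed by scaling the last
group. [folklore] -/
theorem scaleU_last_rename (s : ℕ) (t : ℚ) (H : RU s m) :
    scaleU (s + 1) m (Fin.last s) t
      (rename (fun v : Fin s × Fin (m + 1) => (Fin.castSucc v.1, v.2)) H) =
      rename (fun v : Fin s × Fin (m + 1) => (Fin.castSucc v.1, v.2)) H := by
  have key : (scaleU (s + 1) m (Fin.last s) t).comp
      (rename (R := ℚ) fun v : Fin s × Fin (m + 1) => (Fin.castSucc v.1, v.2)) =
      rename fun v : Fin s × Fin (m + 1) => (Fin.castSucc v.1, v.2) := by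
    refine algHom_ext fun v => ?_
    simp [scaleU, Fin.castSucc_ne_last]
  exact AlgHom.congr_fun key H

/-- **`F(φ_H(u); ·) ≠ 0`**: the specialisation of `F` at the generic point of a hypersurface
`H = 0` of `ℚ[u₁, …, u_s]` is not identically zero — else `H` would divide every coefficient of
`F` in the last group, i.e. `rename H ∣ F` with `F` irreducible of positive degree in that group.
[folklore] -/
theorem map_primeSpecMap_splitLast_ne_zero (h𝔭 : 𝔭.IsPrime)
    (hhom : 𝔭.IsHomogeneous (homogeneousSubmodule (Fin (m + 1)) ℚ))
    (hdim : ringKrullDim (Rx m ⧸ 𝔭) = (s + 1 : ℕ)) {H : RU s m} (hH : Prime H) :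
    MvPolynomial.map (primeSpecMap hH) (splitLast s m (chowForm 𝔭 (s + 1))) ≠ 0 := by
  classical
  haveI := h𝔭
  have hFp : Prime (chowForm 𝔭 (s + 1)) := prime_chowForm 𝔭 hhom (Nat.succ_pos s) hdim
  have hinj : Function.Injective (fun v : Fin s × Fin (m + 1) => (Fin.castSucc v.1, v.2)) :=
    fun a b h => by
      simp only [Prod.mk.injEq, Fin.castSucc_inj] at h
      exact Prod.ext h.1 h.2
  intro h0
  -- `H` divides all coefficients, so `C H ∣ splitLast F` and `rename H ∣ F`
  have hcoef : ∀ e, H ∣ coeff e (splitLast s m (chowForm 𝔭 (s + 1))) := fun e => by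
    rw [← primeSpecMap_eq_zero_iff hH, ← coeff_map, h0, coeff_zero]
  have hCdvd : (C H : MvPolynomial (Fin (m + 1)) (RU s m)) ∣ splitLast s m (chowForm 𝔭 (s + 1)) :=
    (C_dvd_iff_dvd_coeff _ _).mpr hcoef
  have hdvd : rename (fun v : Fin s × Fin (m + 1) => (Fin.castSucc v.1, v.2)) H ∣
      chowForm 𝔭 (s + 1) := by
    have h1 := map_dvd (unsplitLast s m) hCdvd
    rw [unsplitLast_splitLast] at h1
    have e : unsplitLast s m (C H) =
        rename (fun v : Fin s × Fin (m + 1) => (Fin.castSucc v.1, v.2)) H := by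
      rw [unsplitLast, eval₂Hom_C, AlgHom.toRingHom_eq_coe, RingHom.coe_coe]
    rwa [e] at h1
  obtain ⟨K, hK⟩ := hdvd
  have hD : 1 ≤ ideg 𝔭 (s + 1) := one_le_ideg_of_prime_chowForm (Nat.succ_pos s) hFp
  rcases hFp.irreducible.isUnit_or_isUnit hK with hu | hu
  · -- `rename H` a unit: then `H` is a unit
    obtain ⟨r, hr, hrC⟩ := isUnit_iff_eq_C_of_isReduced.mp hu
    have hHC : H = C r := rename_injective _ hinj (by rw [hrC, rename_C])
    exact hH.not_unit (by rw [hHC]; exact hr.map C)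
  · -- `K` a unit: then `F = k · rename H` does not involve the last group, but `deg 𝔭 ≥ 1`
    obtain ⟨r, hr, hrC⟩ := isUnit_iff_eq_C_of_isReduced.mp hu
    have hscale := scaleU_last_chowForm s 𝔭 2
    rw [hK, hrC, map_mul, scaleU_last_rename, ← hrC, ← hK] at hscale
    -- `scaleU K = K` for the constant `K`, so `F = 2^D F`
    have hKs : scaleU (s + 1) m (Fin.last s) 2 K = K := by
      rw [hrC, scaleU, aeval_C, MvPolynomial.algebraMap_eq]
    rw [hKs, ← hK] at hscale
    -- compare a non-zero coefficient
    obtain ⟨e, he⟩ := exists_coeff_ne_zero hFp.ne_zero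
    have hc := congrArg (coeff e) hscale
    rw [coeff_C_mul] at hc
    have h2 : (2 : ℚ) ^ ideg 𝔭 (s + 1) = 1 :=
      mul_right_cancel₀ he (by rw [one_mul]; exact hc.symm)
    have hlt : (1 : ℚ) < 2 ^ ideg 𝔭 (s + 1) := one_lt_pow₀ (by norm_num) (by omega)
    rw [h2] at hlt
    exact lt_irrefl _ hlt

/-- **Every prime factor of the `u`-resultant is the Chow form of a minimal prime of the cut.**
[cite: NesterenkoPhilippon2001, Ch. 3 Prop. 4.11 (pp. 40–41)] -/
theorem exists_associated_chowForm_of_prime_dvd (hs : 1 ≤ s) (h𝔭 : 𝔭.IsPrime)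
    (hhom : 𝔭.IsHomogeneous (homogeneousSubmodule (Fin (m + 1)) ℚ))
    (hunm : IsUnmixedOfRank 𝔭 (s + 1)) (hQ : Q.IsHomogeneous d) (hd : 1 ≤ d) (hQ𝔭 : Q ∉ 𝔭)
    (hQQ₀ : Q = C q * MvPolynomial.map (Int.castRingHom ℚ) Q₀) (hQ₀ : Q₀.IsHomogeneous d)
    {H : RU s m} (hH : Prime H) (hHG : H ∣ uResultant 𝔭 s d Q₀) :
    ∃ 𝔮 ∈ (𝔭 ⊔ Ideal.span {Q}).minimalPrimes, Associated H (chowForm 𝔮 s) := by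
  have hdim : ringKrullDim (Rx m ⧸ 𝔭) = (s + 1 : ℕ) :=
    ringKrullDim_quotient_eq_of_isUnmixedOfRank h𝔭 hunm
  haveI : CharZero (primeSpecField hH) := charZero_primeSpecField hH
  set φ := primeSpecMap hH with hφ
  obtain ⟨cz, bz, hbz0, hbzI, hbzL, hF, hG⟩ := exists_split_primeSpec h𝔭 hhom hdim hQ₀ hH
  have hG0 : φ (uResultant 𝔭 s d Q₀) = 0 := (primeSpecMap_eq_zero_iff hH _).mpr hHG
  rw [hG, mul_eq_zero, pow_eq_zero_iff (by omega : d ≠ 0), Finset.prod_eq_zero_iff] at hG0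
  rcases hG0 with hcz | ⟨i, -, hi⟩
  · exfalso
    rw [hcz, C_0, zero_mul] at hF
    exact map_primeSpecMap_splitLast_ne_zero h𝔭 hhom hdim hH hF
  · -- `bz i` is a zero of `(𝔭, Q)`, hence of a minimal prime `𝔮`, on the hyperplanes `φ(u)`
    have hβ𝔭 : ∀ P ∈ 𝔭, aeval (bz i) P = 0 := (forall_aeval_eq_zero_iff_int 𝔭 (bz i)).mpr (hbzI i)
    have hβQ : aeval (bz i) Q = 0 := aeval_eq_zero_of_int_model hQQ₀ hi
    set I : Ideal (Rx m) := RingHom.ker ((aeval (bz i) : Rx m →ₐ[ℚ] primeSpecField hH) :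
      Rx m →+* primeSpecField hH) with hI
    haveI hIp : I.IsPrime := RingHom.ker_isPrime _
    have hle : 𝔭 ⊔ Ideal.span {Q} ≤ I := by
      refine sup_le (fun P hP => ?_) ?_
      · exact (RingHom.mem_ker).mpr (hβ𝔭 P hP)
      · rw [Ideal.span_le, Set.singleton_subset_iff]
        exact (RingHom.mem_ker).mpr hβQ
    obtain ⟨𝔮, h𝔮min, h𝔮le⟩ := Ideal.exists_minimalPrimes_le hle
    refine ⟨𝔮, h𝔮min, ?_⟩
    obtain ⟨h𝔮p, h𝔮hom, h𝔮dim, hP𝔮, hspan, -, -⟩ := minimalPrime_facts hs h𝔭 hhom hunm hQ hQ𝔭 h𝔮min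
    have hmem : chowForm 𝔮 s ∈ elimIdeal 𝔮 s := by
      rw [← hspan]; exact Ideal.mem_span_singleton_self _
    have hzero : aeval (fun w => φ (X w)) (chowForm 𝔮 s) = 0 :=
      aeval_eq_zero_of_mem_elimIdeal_of_zero hmem (hbz0 i)
        (fun P hP => (RingHom.mem_ker).mp (h𝔮le hP)) (hbzL i)
    rw [← ringHom_eq_aeval φ] at hzero
    exact hH.associated_of_dvd hP𝔮 ((primeSpecMap_eq_zero_iff hH _).mp hzero)

/-- **The `u`-resultant is non-zero** (`Q ∉ 𝔭`: no point of the generic linear section of `V(𝔭)`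
lies on `V(Q)`). [cite: NesterenkoPhilippon2001, Ch. 3 Prop. 4.11 (pp. 40–41)] -/
theorem uResultant_ne_zero (hs : 1 ≤ s) (h𝔭 : 𝔭.IsPrime)
    (hhom : 𝔭.IsHomogeneous (homogeneousSubmodule (Fin (m + 1)) ℚ))
    (hunm : IsUnmixedOfRank 𝔭 (s + 1)) (hQ : Q.IsHomogeneous d) (hd : 1 ≤ d) (hQ𝔭 : Q ∉ 𝔭)
    (hQQ₀ : Q = C q * MvPolynomial.map (Int.castRingHom ℚ) Q₀) (hQ₀ : Q₀.IsHomogeneous d) :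
    uResultant 𝔭 s d Q₀ ≠ 0 := by
  have hdim : ringKrullDim (Rx m ⧸ 𝔭) = (s + 1 : ℕ) :=
    ringKrullDim_quotient_eq_of_isUnmixedOfRank h𝔭 hunm
  intro h0
  obtain ⟨hc, hβsec, -⟩ := splitConst_spec h𝔭 hhom hdim
  have h1 : splitNorm d Q₀ (splitConst 𝔭 s) (splitPts 𝔭 s) = 0 := by
    change uResΩ 𝔭 s d Q₀ = 0
    rw [← algebraMap_uResultant h𝔭 hhom hdim hQ₀, h0, map_zero]
  rw [splitNorm_def, mul_eq_zero, pow_eq_zero_iff (by omega : d ≠ 0), Finset.prod_eq_zero_iff] at h1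
  rcases h1 with h1 | ⟨i, -, hi⟩
  · exact hc h1
  obtain ⟨hβ0, hβ𝔭, hβL⟩ := hβsec i
  have hβQ : aeval (splitPts 𝔭 s i) Q = 0 := aeval_eq_zero_of_int_model hQQ₀ hi
  set I : Ideal (Rx m) := RingHom.ker ((aeval (splitPts 𝔭 s i) : Rx m →ₐ[ℚ] ΩU s m) :
    Rx m →+* ΩU s m) with hI
  haveI hIp : I.IsPrime := RingHom.ker_isPrime _
  have hle : 𝔭 ⊔ Ideal.span {Q} ≤ I := by
    refine sup_le (fun P hP => ?_) ?_
    · exact (RingHom.mem_ker).mpr (hβ𝔭 P hP)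
    · rw [Ideal.span_le, Set.singleton_subset_iff]
      exact (RingHom.mem_ker).mpr hβQ
  obtain ⟨𝔮, h𝔮min, h𝔮le⟩ := Ideal.exists_minimalPrimes_le hle
  obtain ⟨h𝔮p, h𝔮hom, h𝔮dim, hP𝔮, hspan, -, -⟩ := minimalPrime_facts hs h𝔭 hhom hunm hQ hQ𝔭 h𝔮min
  have hmem : chowForm 𝔮 s ∈ elimIdeal 𝔮 s := by
    rw [← hspan]; exact Ideal.mem_span_singleton_self _
  have hzero : aeval (uΩ s m) (chowForm 𝔮 s) = 0 :=
    aeval_eq_zero_of_mem_elimIdeal_of_zero hmem hβ0 (fun P hP => (RingHom.mem_ker).mp (h𝔮le hP))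
      fun i' => by
        rw [← hβL i']
        exact Finset.sum_congr rfl fun j _ => mul_comm _ _
  rw [aeval_uΩ, IsScalarTower.toAlgHom_apply] at hzero
  exact hP𝔮.ne_zero (algebraMap_ΩU_injective s m (by rw [map_zero]; exact hzero))

/-- **`G = c ∏_{𝔮} F_𝔮^{e_𝔮}` with `c ≠ 0` and all `e_𝔮 ≥ 1`** (over the minimal primes `𝔮` of
`(𝔭, Q)`). [cite: NesterenkoPhilippon2001, Ch. 3 Prop. 4.11 (pp. 40–41)] -/
theorem exists_uResultant_eq_C_mul_prod_pow (hs : 1 ≤ s) (hsm : s + 1 ≤ m) (h𝔭 : 𝔭.IsPrime)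
    (hhom : 𝔭.IsHomogeneous (homogeneousSubmodule (Fin (m + 1)) ℚ))
    (hunm : IsUnmixedOfRank 𝔭 (s + 1)) (hQ : Q.IsHomogeneous d) (hd : 1 ≤ d) (hQ𝔭 : Q ∉ 𝔭)
    (hq : q ≠ 0) (hQQ₀ : Q = C q * MvPolynomial.map (Int.castRingHom ℚ) Q₀)
    (hQ₀ : Q₀.IsHomogeneous d) {𝓠 : Finset (Ideal (Rx m))}
    (h𝓠 : (𝓠 : Set (Ideal (Rx m))) = (𝔭 ⊔ Ideal.span {Q}).minimalPrimes) :
    ∃ c : ℚ, c ≠ 0 ∧ ∃ e : Ideal (Rx m) → ℕ, (∀ 𝔮 ∈ 𝓠, 1 ≤ e 𝔮) ∧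
      uResultant 𝔭 s d Q₀ = C c * ∏ 𝔮 ∈ 𝓠, chowForm 𝔮 s ^ e 𝔮 := by
  classical
  set G := uResultant 𝔭 s d Q₀ with hGdef
  have hG0 : G ≠ 0 := uResultant_ne_zero hs h𝔭 hhom hunm hQ hd hQ𝔭 hQQ₀ hQ₀
  have hmem : ∀ 𝔮 ∈ 𝓠, 𝔮 ∈ (𝔭 ⊔ Ideal.span {Q}).minimalPrimes := fun 𝔮 h𝔮 => by
    rw [← h𝓠]; exact Finset.mem_coe.mpr h𝔮
  have hfacts := fun 𝔮 (h𝔮 : 𝔮 ∈ 𝓠) => minimalPrime_facts hs h𝔭 hhom hunm hQ hQ𝔭 (hmem 𝔮 h𝔮)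
  set e : Ideal (Rx m) → ℕ := fun 𝔮 => multiplicity (chowForm 𝔮 s) G with hedef
  -- distinct minimal primes have non-associated Chow forms
  have hne : ∀ 𝔮 ∈ 𝓠, ∀ 𝔮' ∈ 𝓠, 𝔮 ≠ 𝔮' → ¬ chowForm 𝔮 s ∣ chowForm 𝔮' s := by
    intro 𝔮 h𝔮 𝔮' h𝔮' hne hdvd
    apply hne
    obtain ⟨hp, hhom₁, hdim₁, hP, hspan, -⟩ := hfacts 𝔮 h𝔮
    obtain ⟨hp', hhom', hdim', hP', hspan', -⟩ := hfacts 𝔮' h𝔮'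
    have hassoc : Associated (chowForm 𝔮 s) (chowForm 𝔮' s) := hP.associated_of_dvd hP' hdvd
    refine eq_of_elimIdeal_eq m s 𝔮 𝔮' hs (by omega) hhom₁ hp hdim₁ hhom' hp' hdim' ?_
    rw [← hspan, ← hspan', Ideal.span_singleton_eq_span_singleton]
    exact hassoc
  -- `∏ F_𝔮^{e_𝔮}` divides `G`
  have hprod : (∏ 𝔮 ∈ 𝓠, chowForm 𝔮 s ^ e 𝔮) ∣ G := by
    have h := iInf_span_singleton_pow_eq_span_prod 𝓠 (fun 𝔮 => chowForm 𝔮 s) e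
      (fun 𝔮 h𝔮 => (hfacts 𝔮 h𝔮).2.2.2.1) hne
    rw [← Ideal.mem_span_singleton, ← h]
    simp only [Ideal.mem_iInf]
    intro 𝔮 _
    exact Ideal.mem_span_singleton.mpr (pow_multiplicity_dvd _ _)
  obtain ⟨K, hK⟩ := hprod
  have hK0 : K ≠ 0 := by
    rintro rfl
    exact hG0 (by rw [hK, mul_zero])
  -- `K` is a unit: a prime factor of `K` would be an `F_𝔮₀` of too high multiplicity
  have hKu : IsUnit K := by
    by_contra hKu
    obtain ⟨p, hpirr, hpK⟩ := WfDvdMonoid.exists_irreducible_factor hKu hK0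
    have hp : Prime p := UniqueFactorizationMonoid.irreducible_iff_prime.mp hpirr
    have hpG : p ∣ G := hpK.trans (Dvd.intro_left _ hK.symm)
    obtain ⟨𝔮₀, h𝔮₀min, hassoc⟩ :=
      exists_associated_chowForm_of_prime_dvd hs h𝔭 hhom hunm hQ hd hQ𝔭 hQQ₀ hQ₀ hp hpG
    have h𝔮₀ : 𝔮₀ ∈ 𝓠 := by rw [← Finset.mem_coe, h𝓠]; exact h𝔮₀min
    have hfin : FiniteMultiplicity (chowForm 𝔮₀ s) G :=
      FiniteMultiplicity.of_not_isUnit (hfacts 𝔮₀ h𝔮₀).2.2.2.1.not_unit hG0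
    apply hfin.not_pow_dvd_of_multiplicity_lt (Nat.lt_succ_self _)
    have hFK : chowForm 𝔮₀ s ∣ K := hassoc.symm.dvd.trans hpK
    change chowForm 𝔮₀ s ^ (e 𝔮₀ + 1) ∣ G
    rw [hK, ← Finset.mul_prod_erase 𝓠 (fun 𝔮 => chowForm 𝔮 s ^ e 𝔮) h𝔮₀, mul_assoc, pow_succ]
    exact mul_dvd_mul_left _ (dvd_mul_of_dvd_right hFK _)
  obtain ⟨c, hc, hcK⟩ := isUnit_iff_eq_C_of_isReduced.mp hKu
  refine ⟨c, hc.ne_zero, e, fun 𝔮 h𝔮 => ?_, ?_⟩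
  · exact multiplicity_pos_of_dvd
      (chowForm_dvd_uResultant hs h𝔭 hhom hunm hQ hd hQ𝔭 hq hQQ₀ hQ₀ (hmem 𝔮 h𝔮))
  · rw [hK, hcK, mul_comm]

/-- **The unmixed ideal `J` of Proposition 4.11 with associated form the `u`-resultant.** For a
homogeneous prime `𝔭` of rank `s + 1` (`2 ≤ s + 1 ≤ m`) and a form `Q ∉ 𝔭` of degree `d ≥ 1`
with integer model `Q₀`: there is a homogeneous ideal `J`, unmixed of rank `s`, with
`V(J) = V((𝔭, Q))` and `chowForm J s = c · uResultant 𝔭 s d Q₀`, `c ≠ 0` (Proposition 4.4 via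
`exists_cycle_ideal`, and `exists_uResultant_eq_C_mul_prod_pow`).
[cite: NesterenkoPhilippon2001, Ch. 3 Prop. 4.11 (pp. 40–41)] -/
theorem exists_cycle_ideal_uResultant (hs : 1 ≤ s) (hsm : s + 1 ≤ m) (h𝔭 : 𝔭.IsPrime)
    (hhom : 𝔭.IsHomogeneous (homogeneousSubmodule (Fin (m + 1)) ℚ))
    (hunm : IsUnmixedOfRank 𝔭 (s + 1)) (hQ : Q.IsHomogeneous d) (hd : 1 ≤ d) (hQ𝔭 : Q ∉ 𝔭)
    (hq : q ≠ 0) (hQQ₀ : Q = C q * MvPolynomial.map (Int.castRingHom ℚ) Q₀)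
    (hQ₀ : Q₀.IsHomogeneous d) :
    ∃ (J : Ideal (Rx m)) (c : ℚ), J.IsHomogeneous (homogeneousSubmodule (Fin (m + 1)) ℚ) ∧
      IsUnmixedOfRank J s ∧ projZeros J = projZeros (𝔭 ⊔ Ideal.span {Q}) ∧ c ≠ 0 ∧
      chowForm J s = C c * uResultant 𝔭 s d Q₀ := by
  classical
  obtain ⟨𝓠, h𝓠, -⟩ := exists_finset_minimalPrimes_cut hhom h𝔭.ne_top hQ hd
  obtain ⟨c, hc, e, he, hG⟩ :=
    exists_uResultant_eq_C_mul_prod_pow hs hsm h𝔭 hhom hunm hQ hd hQ𝔭 hq hQQ₀ hQ₀ h𝓠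
  obtain ⟨J, hJhom, hJunm, hJV, -, -, ⟨c₁, hc₁, hJF⟩, -⟩ :=
    exists_cycle_ideal NesterenkoPhilippon2001_ch3_prop_4_4_holds (r := s + 1) (by omega) hsm h𝔭
      hhom hunm hQ hd hQ𝔭 h𝓠 e he
  rw [Nat.add_sub_cancel] at hJunm hJF
  refine ⟨J, c₁ / c, hJhom, hJunm, hJV, div_ne_zero hc₁ hc, ?_⟩
  rw [hJF, hG, ← mul_assoc, ← map_mul, div_mul_cancel₀ c₁ hc]

end Setting

end Nesterenko

end Literature.NumberTheory.Transcendental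

end
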